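import Summits.RiemannHypothesis.RiemannHypothesis.Theorems.PfPersistenceDownCone
import Summits.RiemannHypothesis.RiemannHypothesis.Theorems.PfPersistenceBarrierExplicitDatum
import Summits.RiemannHypothesis.RiemannHypothesis.Theorems.PfPersistenceLocalityBarrier
import Literature.NumberTheory.LFunctions.WeilGroundEnergyParitySplit
import Literature.NumberTheory.LFunctions.WeilTwoPrimePos59
import HarnessLib

/-!
# PF persistence, fake seat 4 — down-cone ENERGY FORM, NODAL FORCING and the class statements

Part 2 of `PfPersistenceDownCone` (unit `pub-rhpf-fake-4`, `pub-rhpf` cell; mechanism / rigidity campaign;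
**no RH claims**). From the down-cone monotonicity `Re Q_ζ(f) ≤ Re Q_{w'}(f)` on one-signed real window tests
(part 1, `re_weilQuadratic_le_of_oneSigned`):
* (ENERGY FORM) `ε(a) ‖f‖² ≤ Re Q_{w'}(f)` (and the even version) for one-signed `f`;
* (NODAL FORCING) `Re Q_{w'}(f) < Re Q_ζ(f)` — in particular `< ε(a)‖f‖²`, or `< 0` at a `ζ`-positive window —
  forces `f` to CHANGE SIGN; unconditionally for `a ≤ 59/100`, at every window under RH;
* (§7) the window-localised form matching the admissible-class primitive `OneSigned`;
* (§8) the named class `Prop`s `DownCone`, `NodalForcingOn`, `OneSignedFloorOn` for the cell's CLOSED / GAP rows,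
  with `oneSignedFloorOn_all`, `nodalForcingOn_of_le_59_100`, `nodalForcingOn_of_weilPositivityOn`,
  `nodalForcingOn_of_riemannHypothesis`.
References as in part 1 (Weil 1952; Bombieri 2000 Thm 2, §4; Yoshida 1992 §2; Harper arXiv:1703.06654 — model only).
-/

set_option linter.dupNamespace false  -- the mandated namespace repeats `RiemannHypothesis`

noncomputable section

open MeasureTheory Set Filter Complex
open scoped Real Topology ComplexConjugate ContDiff

namespace Summit.RiemannHypothesis.RiemannHypothesis.Theorems.PfPersistenceDownCone

open Literature.NumberTheory.LFunctions
open Summit.RiemannHypothesis.RiemannHypothesis.Theorems.PfPersistenceBarrier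
open Summit.RiemannHypothesis.RiemannHypothesis.Theorems.PfPersistenceBarrier.ExplicitDatum

variable {a : ℝ}

/-! ## §5 Energy form: one-signed states of a down-cone fake lie above `ζ`'s ground energy -/

/-- `sInf S_P(a) · ‖f‖² ≤ Re Q_{w'}(f)` for one-signed real window tests with a scaling-stable
constraint `P` (from the tree's homogeneous bound for `ζ`). [cite: Bombieri2000Weil, §4 Problem 2 (p. 193)] -/
theorem sInf_sphereValues_mul_le_re_quadratic_of_oneSigned {w' : ℕ → ℝ}
    (hle : ∀ n, w' n ≤ zetaTable n) {f : ℝ → ℝ} (h1 : (∀ t, 0 ≤ f t) ∨ (∀ t, f t ≤ 0))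
    (hg : IsWeilTest fun t ↦ (f t : ℂ)) (hsupp : tsupport (fun t ↦ (f t : ℂ)) ⊆ Icc (-a) a)
    {P : (ℝ → ℂ) → Prop} (hP : ∀ c : ℝ, 0 < c → P fun t ↦ (c : ℂ) * (f t : ℂ)) :
    sInf (weilWindowSphereValues P a) * ∫ t, ‖(f t : ℂ)‖ ^ 2 ≤
      ((tableDatum w').quadratic fun t ↦ (f t : ℂ)).re :=
  (sInf_weilWindowSphereValues_mul_le_re hg hsupp hP).trans
    (re_weilQuadratic_le_of_oneSigned hle h1 hg hsupp)

/-- **`ε(a) ‖f‖² ≤ Re Q_{w'}(f)`** for every down-cone table `w' ≤ w_ζ` and one-signed real test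
`f` on `[-a, a]`. [cite: Bombieri2000Weil, §4 Problem 2 (p. 193)] -/
theorem weilGroundEnergy_mul_le_re_quadratic_of_oneSigned {w' : ℕ → ℝ}
    (hle : ∀ n, w' n ≤ zetaTable n) {f : ℝ → ℝ} (h1 : (∀ t, 0 ≤ f t) ∨ (∀ t, f t ≤ 0))
    (hg : IsWeilTest fun t ↦ (f t : ℂ)) (hsupp : tsupport (fun t ↦ (f t : ℂ)) ⊆ Icc (-a) a) :
    weilGroundEnergy a * ∫ t, ‖(f t : ℂ)‖ ^ 2 ≤ ((tableDatum w').quadratic fun t ↦ (f t : ℂ)).re := by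
  rw [weilGroundEnergy_eq_sInf]
  exact sInf_sphereValues_mul_le_re_quadratic_of_oneSigned hle h1 hg hsupp fun _ _ ↦ trivial

/-- **`ε_ev(a) ‖f‖² ≤ Re Q_{w'}(f)`** for EVEN one-signed real tests (the even sector, where the
observatory's `ε₁` and ground-state profile live). [cite: Bombieri2000Weil, §4 Thm. 5 (p. 197), μ⁺(M)] -/
theorem weilEvenGroundEnergy_mul_le_re_quadratic_of_oneSigned {w' : ℕ → ℝ}
    (hle : ∀ n, w' n ≤ zetaTable n) {f : ℝ → ℝ} (h1 : (∀ t, 0 ≤ f t) ∨ (∀ t, f t ≤ 0))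
    (hev : ∀ t, f (-t) = f t)
    (hg : IsWeilTest fun t ↦ (f t : ℂ)) (hsupp : tsupport (fun t ↦ (f t : ℂ)) ⊆ Icc (-a) a) :
    weilEvenGroundEnergy a * ∫ t, ‖(f t : ℂ)‖ ^ 2 ≤
      ((tableDatum w').quadratic fun t ↦ (f t : ℂ)).re := by
  rw [weilEvenGroundEnergy_eq_sInf]
  exact sInf_sphereValues_mul_le_re_quadratic_of_oneSigned hle h1 hg hsupp
    fun c _ t ↦ by simp only [hev t]

/-! ## §6 Nodal forcing -/

/-- **DOWN-CONE NODAL FORCING.** If a real window test does better for the down-cone fake than for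
`ζ` — `Re Q_{w'}(f) < Re Q_ζ(f)` — then `f` changes sign. [folklore] -/
theorem sign_change_of_re_quadratic_lt {w' : ℕ → ℝ} (hle : ∀ n, w' n ≤ zetaTable n) {f : ℝ → ℝ}
    (hg : IsWeilTest fun t ↦ (f t : ℂ)) (hsupp : tsupport (fun t ↦ (f t : ℂ)) ⊆ Icc (-a) a)
    (hlt : ((tableDatum w').quadratic fun t ↦ (f t : ℂ)).re < (weilQuadratic fun t ↦ (f t : ℂ)).re) :
    (∃ s, f s < 0) ∧ ∃ t, 0 < f t := by
  by_contra h
  have h1 : (∀ t, 0 ≤ f t) ∨ (∀ t, f t ≤ 0) := by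
    rw [not_and_or, not_exists, not_exists] at h
    rcases h with h | h
    · exact Or.inl fun t ↦ not_lt.1 (h t)
    · exact Or.inr fun t ↦ not_lt.1 (h t)
  exact absurd hlt (not_lt.2 (re_weilQuadratic_le_of_oneSigned hle h1 hg hsupp))

/-- **Energy form**: `Re Q_{w'}(f) < ε(a) ‖f‖²` forces a sign change of `f`. [folklore] -/
theorem sign_change_of_re_quadratic_lt_groundEnergy {w' : ℕ → ℝ} (hle : ∀ n, w' n ≤ zetaTable n)
    {f : ℝ → ℝ} (hg : IsWeilTest fun t ↦ (f t : ℂ))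
    (hsupp : tsupport (fun t ↦ (f t : ℂ)) ⊆ Icc (-a) a)
    (hlt : ((tableDatum w').quadratic fun t ↦ (f t : ℂ)).re < weilGroundEnergy a * ∫ t, ‖(f t : ℂ)‖ ^ 2) :
    (∃ s, f s < 0) ∧ ∃ t, 0 < f t := by
  by_contra h
  have h1 : (∀ t, 0 ≤ f t) ∨ (∀ t, f t ≤ 0) := by
    rw [not_and_or, not_exists, not_exists] at h
    rcases h with h | h
    · exact Or.inl fun t ↦ not_lt.1 (h t)
    · exact Or.inr fun t ↦ not_lt.1 (h t)
  exact absurd hlt (not_lt.2 (weilGroundEnergy_mul_le_re_quadratic_of_oneSigned hle h1 hg hsupp))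

/-- **Even energy form** (the observatory's sector): an EVEN real window test with
`Re Q_{w'}(f) < ε_ev(a) ‖f‖²` changes sign — a down-cone fake whose even bottom drops below `ζ`'s
has a NODAL even ground direction. [folklore] -/
theorem sign_change_of_re_quadratic_lt_evenGroundEnergy {w' : ℕ → ℝ}
    (hle : ∀ n, w' n ≤ zetaTable n) {f : ℝ → ℝ} (hev : ∀ t, f (-t) = f t)
    (hg : IsWeilTest fun t ↦ (f t : ℂ)) (hsupp : tsupport (fun t ↦ (f t : ℂ)) ⊆ Icc (-a) a)
    (hlt : ((tableDatum w').quadratic fun t ↦ (f t : ℂ)).re <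
      weilEvenGroundEnergy a * ∫ t, ‖(f t : ℂ)‖ ^ 2) :
    (∃ s, f s < 0) ∧ ∃ t, 0 < f t := by
  by_contra h
  have h1 : (∀ t, 0 ≤ f t) ∨ (∀ t, f t ≤ 0) := by
    rw [not_and_or, not_exists, not_exists] at h
    rcases h with h | h
    · exact Or.inl fun t ↦ not_lt.1 (h t)
    · exact Or.inr fun t ↦ not_lt.1 (h t)
  exact absurd hlt
    (not_lt.2 (weilEvenGroundEnergy_mul_le_re_quadratic_of_oneSigned hle h1 hev hg hsupp))

/-- **At a `ζ`-positive window every negative direction of a down-cone fake is nodal.** [folklore] -/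
theorem sign_change_of_re_quadratic_neg_of_weilPositivityOn (hpos : WeilPositivityOn a)
    {w' : ℕ → ℝ} (hle : ∀ n, w' n ≤ zetaTable n) {f : ℝ → ℝ}
    (hg : IsWeilTest fun t ↦ (f t : ℂ)) (hsupp : tsupport (fun t ↦ (f t : ℂ)) ⊆ Icc (-a) a)
    (hneg : ((tableDatum w').quadratic fun t ↦ (f t : ℂ)).re < 0) :
    (∃ s, f s < 0) ∧ ∃ t, 0 < f t :=
  sign_change_of_re_quadratic_lt hle hg hsupp (hneg.trans_le (hpos _ hg hsupp))

/-- **Unconditional instance**: on every window `a ≤ 59/100` (where `Q_ζ ≥ 0` is PROVED in the tree,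
`weilPositivityOn_59_100`) every negative direction of every down-cone fake — sign twist, deletion,
`F₋` dial — changes sign. [folklore] -/
theorem sign_change_of_re_quadratic_neg_59_100 (ha : a ≤ 59 / 100)
    {w' : ℕ → ℝ} (hle : ∀ n, w' n ≤ zetaTable n) {f : ℝ → ℝ}
    (hg : IsWeilTest fun t ↦ (f t : ℂ)) (hsupp : tsupport (fun t ↦ (f t : ℂ)) ⊆ Icc (-a) a)
    (hneg : ((tableDatum w').quadratic fun t ↦ (f t : ℂ)).re < 0) :
    (∃ s, f s < 0) ∧ ∃ t, 0 < f t :=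
  sign_change_of_re_quadratic_neg_of_weilPositivityOn
    (fun g hg' hs ↦ weilPositivityOn_59_100 g hg' (hs.trans (Icc_subset_Icc (by linarith) ha)))
    hle hg hsupp hneg

/-- **Under RH, at every window.** [folklore] -/
theorem sign_change_of_re_quadratic_neg_of_riemannHypothesis (hRH : RiemannHypothesis)
    {w' : ℕ → ℝ} (hle : ∀ n, w' n ≤ zetaTable n) {f : ℝ → ℝ}
    (hg : IsWeilTest fun t ↦ (f t : ℂ)) (hsupp : tsupport (fun t ↦ (f t : ℂ)) ⊆ Icc (-a) a)
    (hneg : ((tableDatum w').quadratic fun t ↦ (f t : ℂ)).re < 0) :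
    (∃ s, f s < 0) ∧ ∃ t, 0 < f t :=
  sign_change_of_re_quadratic_neg_of_weilPositivityOn
    (fun g hg' _ ↦ weil_criterion_holds.1 hRH g hg') hle hg hsupp hneg

/-- **RMF form.** For a real twist `f ≤ 1` (Rademacher RMF, deletion, `F₋` dial) and a real window
test `θ` with `Re Q_{f·w_ζ}(θ) < Re Q_ζ(θ)`: `θ` changes sign. [folklore] -/
theorem rmf_sign_change {f : ℕ → ℝ} (hf : ∀ n, f n ≤ 1) {θ : ℝ → ℝ}
    (hg : IsWeilTest fun t ↦ (θ t : ℂ)) (hsupp : tsupport (fun t ↦ (θ t : ℂ)) ⊆ Icc (-a) a)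
    (hlt : ((tableDatum (twistTable f)).quadratic fun t ↦ (θ t : ℂ)).re <
      (weilQuadratic fun t ↦ (θ t : ℂ)).re) :
    (∃ s, θ s < 0) ∧ ∃ t, 0 < θ t :=
  sign_change_of_re_quadratic_lt (twistTable_le_zetaTable hf) hg hsupp hlt

/-! ## §7 Window-localised form (matching the admissible-class primitive `OneSigned`) -/

/-- A real window test vanishes off the window. [folklore] -/
theorem apply_eq_zero_of_not_mem_window {f : ℝ → ℝ}
    (hsupp : tsupport (fun t ↦ (f t : ℂ)) ⊆ Icc (-a) a) {t : ℝ} (ht : t ∉ Icc (-a) a) : f t = 0 := by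
  by_contra hne
  have hmem : t ∈ Function.support (fun t ↦ (f t : ℂ)) := by
    rw [Function.mem_support]
    exact_mod_cast hne
  exact ht (hsupp (subset_tsupport _ hmem))

/-- A point where a real window test is nonzero lies in the window. [folklore] -/
theorem mem_window_of_ne_zero {f : ℝ → ℝ}
    (hsupp : tsupport (fun t ↦ (f t : ℂ)) ⊆ Icc (-a) a) {t : ℝ} (ht : f t ≠ 0) : t ∈ Icc (-a) a := by
  by_contra h
  exact ht (apply_eq_zero_of_not_mem_window hsupp h)

/-- One-signedness ON THE WINDOW is one-signedness (the test vanishes elsewhere). [folklore] -/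
theorem oneSigned_of_oneSigned_on_window {f : ℝ → ℝ}
    (hsupp : tsupport (fun t ↦ (f t : ℂ)) ⊆ Icc (-a) a)
    (h1 : (∀ x ∈ Icc (-a) a, 0 ≤ f x) ∨ (∀ x ∈ Icc (-a) a, f x ≤ 0)) :
    (∀ t, 0 ≤ f t) ∨ (∀ t, f t ≤ 0) := by
  rcases h1 with h | h
  · refine Or.inl fun t ↦ ?_
    by_cases ht : t ∈ Icc (-a) a
    · exact h t ht
    · exact (apply_eq_zero_of_not_mem_window hsupp ht).symm.le
  · refine Or.inr fun t ↦ ?_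
    by_cases ht : t ∈ Icc (-a) a
    · exact h t ht
    · exact (apply_eq_zero_of_not_mem_window hsupp ht).le

/-- **DOWN-CONE NODAL FORCING, window form.** `w' ≤ w_ζ`, `f` a real test on `[-a, a]` with
`Re Q_{w'}(f) < Re Q_ζ(f)`: `f` takes BOTH signs INSIDE the window — the profile is not `OneSigned`
in the sense of `PfPersistenceAdmissibleClass`. [folklore] -/
theorem sign_change_on_window_of_re_quadratic_lt {w' : ℕ → ℝ} (hle : ∀ n, w' n ≤ zetaTable n)
    {f : ℝ → ℝ} (hg : IsWeilTest fun t ↦ (f t : ℂ))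
    (hsupp : tsupport (fun t ↦ (f t : ℂ)) ⊆ Icc (-a) a)
    (hlt : ((tableDatum w').quadratic fun t ↦ (f t : ℂ)).re < (weilQuadratic fun t ↦ (f t : ℂ)).re) :
    (∃ s ∈ Icc (-a) a, f s < 0) ∧ ∃ t ∈ Icc (-a) a, 0 < f t := by
  obtain ⟨⟨s, hs⟩, ⟨t, ht⟩⟩ := sign_change_of_re_quadratic_lt hle hg hsupp hlt
  exact ⟨⟨s, mem_window_of_ne_zero hsupp hs.ne, hs⟩, ⟨t, mem_window_of_ne_zero hsupp ht.ne', ht⟩⟩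

/-- **Window form at a `ζ`-positive window**: a negative direction of a down-cone fake is nodal
inside the window. [folklore] -/
theorem sign_change_on_window_of_neg (hpos : WeilPositivityOn a)
    {w' : ℕ → ℝ} (hle : ∀ n, w' n ≤ zetaTable n) {f : ℝ → ℝ}
    (hg : IsWeilTest fun t ↦ (f t : ℂ)) (hsupp : tsupport (fun t ↦ (f t : ℂ)) ⊆ Icc (-a) a)
    (hneg : ((tableDatum w').quadratic fun t ↦ (f t : ℂ)).re < 0) :
    (∃ s ∈ Icc (-a) a, f s < 0) ∧ ∃ t ∈ Icc (-a) a, 0 < f t :=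
  sign_change_on_window_of_re_quadratic_lt hle hg hsupp (hneg.trans_le (hpos _ hg hsupp))

/-- **`F₋`-dial form** (FRAMING §3a: nodal-at-flip is forced in the `F₋` direction): for `K ≤ 1`, at a
`ζ`-positive window reaching `p` or not, every real test on which the dialled form is negative changes
sign inside the window. [folklore] -/
theorem dial_sign_change_on_window (hpos : WeilPositivityOn a) {p : ℕ} {K : ℝ} (hK : K ≤ 1)
    {f : ℝ → ℝ} (hg : IsWeilTest fun t ↦ (f t : ℂ))
    (hsupp : tsupport (fun t ↦ (f t : ℂ)) ⊆ Icc (-a) a)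
    (hneg : ((tableDatum (PfPersistence.dial p K PfPersistence.zetaWeights)).quadratic
      fun t ↦ (f t : ℂ)).re < 0) :
    (∃ s ∈ Icc (-a) a, f s < 0) ∧ ∃ t ∈ Icc (-a) a, 0 < f t :=
  sign_change_on_window_of_neg hpos (dial_le_zetaTable hK) hg hsupp hneg

/-- **Deletion form**: same for the table with any set of prime powers deleted. [folklore] -/
theorem delete_sign_change_on_window (hpos : WeilPositivityOn a) (S : Set ℕ)
    {f : ℝ → ℝ} (hg : IsWeilTest fun t ↦ (f t : ℂ))
    (hsupp : tsupport (fun t ↦ (f t : ℂ)) ⊆ Icc (-a) a)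
    (hneg : ((tableDatum (deleteTable S)).quadratic fun t ↦ (f t : ℂ)).re < 0) :
    (∃ s ∈ Icc (-a) a, f s < 0) ∧ ∃ t ∈ Icc (-a) a, 0 < f t :=
  sign_change_on_window_of_neg hpos (deleteTable_le_zetaTable S) hg hsupp hneg

/-- **RMF form**: same for every real twist `f ≤ 1` (Rademacher random multiplicative functions). [folklore] -/
theorem rmf_sign_change_on_window (hpos : WeilPositivityOn a) {f : ℕ → ℝ} (hf : ∀ n, f n ≤ 1)
    {θ : ℝ → ℝ} (hg : IsWeilTest fun t ↦ (θ t : ℂ))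
    (hsupp : tsupport (fun t ↦ (θ t : ℂ)) ⊆ Icc (-a) a)
    (hneg : ((tableDatum (twistTable f)).quadratic fun t ↦ (θ t : ℂ)).re < 0) :
    (∃ s ∈ Icc (-a) a, θ s < 0) ∧ ∃ t ∈ Icc (-a) a, 0 < θ t :=
  sign_change_on_window_of_neg hpos (twistTable_le_zetaTable hf) hg hsupp hneg


/-! ## 8. The class statements (named `Prop`s for the cell's CLOSED/GAP rows)

`DownCone w'` is the domain; `NodalForcingOn a` says: at window `a`, every down-cone table whose
form is negative on a real window test forces that test to change sign inside the window (so a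
primitive that declares "positive" on one-signed ground states is SOUND on the down-cone there);
`OneSignedFloorOn a` says one-signed states never go below ζ's own ground energy `ε(a)`. -/

/-- The DOWN-CONE of ζ's prime table: real tables `w' ≤ Λ(n)/√n` pointwise. [folklore] -/
def DownCone (w' : ℕ → ℝ) : Prop := ∀ n, w' n ≤ zetaTable n

/-- Twist tables with `f ≤ 1` are down-cone. [folklore] -/
theorem downCone_twistTable {f : ℕ → ℝ} (hf : ∀ n, f n ≤ 1) : DownCone (twistTable f) :=
  twistTable_le_zetaTable hf

/-- Deletion tables are down-cone. [folklore] -/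
theorem downCone_deleteTable (S : Set ℕ) : DownCone (deleteTable S) :=
  deleteTable_le_zetaTable S

/-- Dials with `K ≤ 1` are down-cone. [folklore] -/
theorem downCone_dial {p : ℕ} {K : ℝ} (hK : K ≤ 1) :
    DownCone (PfPersistence.dial p K PfPersistence.zetaWeights) :=
  fun n ↦ dial_le_zetaTable hK n

/-- NODAL FORCING at window `a` on the down-cone: a negative form value on a real window test
forces a sign change of the test inside `[-a, a]`. [folklore] -/
def NodalForcingOn (a : ℝ) : Prop :=
  ∀ ⦃w' : ℕ → ℝ⦄, DownCone w' → ∀ ⦃f : ℝ → ℝ⦄, IsWeilTest (fun t ↦ (f t : ℂ)) →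
    tsupport (fun t ↦ (f t : ℂ)) ⊆ Icc (-a) a →
    ((tableDatum w').quadratic fun t ↦ (f t : ℂ)).re < 0 →
    (∃ s ∈ Icc (-a) a, f s < 0) ∧ ∃ t ∈ Icc (-a) a, 0 < f t

/-- ONE-SIGNED ENERGY FLOOR at window `a` on the down-cone: `ε(a)‖f‖² ≤ Re Q_{w'}(f)` for
one-signed real window tests. [folklore] -/
def OneSignedFloorOn (a : ℝ) : Prop :=
  ∀ ⦃w' : ℕ → ℝ⦄, DownCone w' → ∀ ⦃f : ℝ → ℝ⦄, ((∀ t, 0 ≤ f t) ∨ (∀ t, f t ≤ 0)) →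
    IsWeilTest (fun t ↦ (f t : ℂ)) → tsupport (fun t ↦ (f t : ℂ)) ⊆ Icc (-a) a →
    weilGroundEnergy a * ∫ t, ‖(f t : ℂ)‖ ^ 2 ≤ ((tableDatum w').quadratic fun t ↦ (f t : ℂ)).re

/-- The one-signed energy floor holds at EVERY window, unconditionally. [folklore] -/
theorem oneSignedFloorOn_all (a : ℝ) : OneSignedFloorOn a :=
  fun _ hle _ h1 hg hsupp ↦ weilGroundEnergy_mul_le_re_quadratic_of_oneSigned hle h1 hg hsupp

/-- Nodal forcing holds at every window where ζ is Weil-positive. [folklore] -/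
theorem nodalForcingOn_of_weilPositivityOn (hpos : WeilPositivityOn a) : NodalForcingOn a :=
  fun _ hle _ hg hsupp hneg ↦ sign_change_on_window_of_neg hpos hle hg hsupp hneg

/-- Nodal forcing holds unconditionally at every window `a ≤ 59/100`. [folklore] -/
theorem nodalForcingOn_of_le_59_100 (ha : a ≤ 59 / 100) : NodalForcingOn a :=
  nodalForcingOn_of_weilPositivityOn
    fun g hg hs ↦ weilPositivityOn_59_100 g hg (hs.trans (Icc_subset_Icc (by linarith) ha))

/-- Nodal forcing holds at every window under RH. [folklore] -/
theorem nodalForcingOn_of_riemannHypothesis (hRH : RiemannHypothesis) (a : ℝ) :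
    NodalForcingOn a :=
  nodalForcingOn_of_weilPositivityOn fun _ hg _ ↦ (weil_criterion_holds.1 hRH) _ hg

end Summit.RiemannHypothesis.RiemannHypothesis.Theorems.PfPersistenceDownCone

end
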